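import Mathlib
import HarnessLib
import Summits.Ventures.LatticeQCDFlow.Exactness.SU2ExactForceWilson
import Summits.Ventures.LatticeQCDFlow.Exactness.SU2WilsonFlowLOMemberContinuity
import Literature.Probability.LatticeModels.SixVertexSpectralLastIdentity

/-!
# Calculus for the `SU(2)` kick: `cos(ε√(w·w))` and `sinc(ε√(w·w))` are differentiable on all of `ℝ³`; Lüscher's determinant in `sinc` form is a differentiable function of `j ∈ ℝ⁴`; the booked per-link factor IS that form

HONEST FRAMING: exact (Metropolis-corrected) sampling algorithms for lattice gauge theory;
figures of merit are autocorrelation/cost numbers at stated couplings and volumes; no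
continuum-physics claim.

Venture `LatticeQCDFlow` (cell pub-lqcd), topic `Exactness`; FANOUT row 14 (`eng-flowhmc`).  NEW WORK
of the cell; nothing is cited as a fact; no number.  Support file for `SU2WilsonFlowLOSmooth`
(differentiability of the LO member's pulled-back action along the drift).  The only non-polynomial
ingredients of the booked density (GEN-10's case-free form `luscherIf_eq_sinc`) are `cos(ε√s)` and
`sinc(ε√s)` of `s = |j⃗|²`; as functions of `j⃗ ∈ ℝ³` they are differentiable EVERYWHERE — away from
`0` by the chain rule, at `0` because they are stationary to second order.

* `dotProduct_self_le_three_mul_norm_sq`, `differentiable_dotProduct_self`, `isLittleO_norm_sq`,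
  `hasFDerivAt_zero_of_sq_bound` (a function vanishing to second order at `0` has derivative `0`),
  `abs_sinc_sub_one_le` (`|sinc x − 1| ≤ x²`, from
  Mathlib's `x − x³/6 < sin x < x`);
* **`differentiable_cos_sqrt_dotProduct`**, **`differentiable_sinc_sqrt_dotProduct`**,
  **`differentiable_luscherSinc`**;
* `differentiable_vecQuat`, `differentiable_quatVec`, `differentiable_conjTranspose_two` (ℝ-linear maps);
* **`su2KickJacFix_eq_luscherSinc`** — the booked per-link factor
  `(if sin (angle J (vecQuat U)) = 0 then (1 − ε‖J‖cos …)³ else kickJac (ε‖J‖) 2 (angle …))` equals the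
  `sinc` form at `j = vecQuat (Uᴴ · quatVec J)` (GEN-8's `luscherDet_closedForm_eq_booked` + GEN-10's
  `luscherIf_eq_sinc`, as a named lemma).

NOT CLAIMED: higher smoothness (true, not needed); any number.
-/

noncomputable section

namespace Summit.Ventures.LatticeQCDFlow.Exactness

open WithLp NormedSpace InnerProductGeometry Filter Asymptotics Topology
open Literature.MathematicalPhysics.QuantumFieldTheory Summit.Ventures.LatticeQCDFlow.Scoring
open scoped Matrix Matrix.Norms.Operator

set_option backward.isDefEq.respectTransparency false

/-! ## Calculus: `w ↦ cos (ε √(w·w))` and `w ↦ sinc (ε √(w·w))` are differentiable on `ℝ³` -/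

section Calculus

/-- `w · w ≤ 3 ‖w‖²` for the sup norm on `Fin 3 → ℝ`. -/
theorem dotProduct_self_le_three_mul_norm_sq (w : Fin 3 → ℝ) : dotProduct w w ≤ 3 * ‖w‖ ^ 2 := by
  have h : ∀ i, w i * w i ≤ ‖w‖ ^ 2 := fun i => by
    have hi : |w i| ≤ ‖w‖ := by
      have := norm_le_pi_norm w i
      rwa [Real.norm_eq_abs] at this
    nlinarith [abs_nonneg (w i), sq_abs (w i)]
  simp only [dotProduct, Fin.sum_univ_three]
  linarith [h 0, h 1, h 2]

/-- `w ↦ w · w` is differentiable. -/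
theorem differentiable_dotProduct_self : Differentiable ℝ (fun w : Fin 3 → ℝ => dotProduct w w) := by
  have h : (fun w : Fin 3 → ℝ => dotProduct w w) = fun w => ∑ i, w i * w i := by
    funext w; rfl
  rw [h]
  exact Differentiable.fun_sum fun i _ => (differentiable_apply i).mul (differentiable_apply i)

/-- `‖h‖² = o(h)` at `0`. -/
theorem isLittleO_norm_sq {F : Type*} [NormedAddCommGroup F] :
    (fun h : F => ‖h‖ ^ 2) =o[𝓝 0] (fun h : F => h) := by
  refine isLittleO_norm_right.mp ?_
  have h := (isLittleO_pow_pow (𝕜 := ℝ) one_lt_two).comp_tendsto (tendsto_norm_zero (E := F))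
  simpa [Function.comp_def] using h

/-- A function vanishing to second order at `0` has derivative `0` there. -/
theorem hasFDerivAt_zero_of_sq_bound {F : Type*} [NormedAddCommGroup F] [NormedSpace ℝ F]
    {f : F → ℝ} {C : ℝ} (hf0 : f 0 = 0) (hf : ∀ h, |f h| ≤ C * ‖h‖ ^ 2) :
    HasFDerivAt f (0 : F →L[ℝ] ℝ) 0 := by
  rw [hasFDerivAt_iff_isLittleO_nhds_zero]
  have h1 : (fun h : F => f (0 + h) - f 0 - (0 : F →L[ℝ] ℝ) h) =O[𝓝 0] (fun h : F => ‖h‖ ^ 2) := by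
    refine IsBigO.of_bound C (Filter.Eventually.of_forall fun h => ?_)
    simp only [zero_add, hf0, sub_zero, zero_apply, Real.norm_eq_abs]
    rw [abs_of_nonneg (by positivity : (0 : ℝ) ≤ ‖h‖ ^ 2)]
    exact hf h
  exact h1.trans_isLittleO isLittleO_norm_sq

/-- `|sinc x − 1| ≤ x²` (from `x − x³/6 < sin x < x` for `x > 0`, and evenness). -/
theorem abs_sinc_sub_one_le (x : ℝ) : |Real.sinc x - 1| ≤ x ^ 2 := by
  -- reduce to `0 ≤ x`
  wlog hx : 0 ≤ x generalizing x
  · have h := this (-x) (by linarith)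
    rwa [Real.sinc_neg, neg_sq] at h
  rcases hx.eq_or_lt with rfl | hpos
  · simp
  rw [Real.sinc_of_ne_zero hpos.ne']
  have hlt : Real.sin x < x := Real.sin_lt hpos
  have hgt : x - x ^ 3 / 6 < Real.sin x := Real.sin_gt_sub_cube hpos
  have hle1 : Real.sin x / x ≤ 1 := by
    rw [div_le_one hpos]
    exact hlt.le
  have hge : 1 - x ^ 2 / 6 ≤ Real.sin x / x := by
    rw [le_div_iff₀ hpos]
    nlinarith
  rw [abs_sub_comm, abs_of_nonneg (by linarith)]
  nlinarith [sq_nonneg x]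

/-- **`w ↦ cos (ε √(w · w))` is differentiable on `ℝ³`** (at `w = 0` it vanishes to second order). -/
theorem differentiable_cos_sqrt_dotProduct (ε : ℝ) :
    Differentiable ℝ (fun w : Fin 3 → ℝ => Real.cos (ε * √(dotProduct w w))) := by
  intro w
  by_cases hw : w = 0
  · subst hw
    have h : HasFDerivAt (fun w : Fin 3 → ℝ => Real.cos (ε * √(dotProduct w w)) - 1) (0 : (Fin 3 → ℝ) →L[ℝ] ℝ) 0 := by
      refine hasFDerivAt_zero_of_sq_bound (C := 3 * ε ^ 2 / 2) (by simp) fun h => ?_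
      calc |Real.cos (ε * √(dotProduct h h)) - 1| ≤ (ε * √(dotProduct h h)) ^ 2 / 2 := Literature.Probability.LatticeModels.SixVertex.abs_cos_sub_one_le _
        _ = ε ^ 2 * dotProduct h h / 2 := by
            rw [mul_pow, Real.sq_sqrt (dotProduct_self_nonneg_fin3 h)]
        _ ≤ 3 * ε ^ 2 / 2 * ‖h‖ ^ 2 := by
            have := dotProduct_self_le_three_mul_norm_sq h
            nlinarith [sq_nonneg ε]
    have h2 := h.differentiableAt.add_const 1
    simp only [sub_add_cancel] at h2
    exact h2
  · have hpos : 0 < dotProduct w w :=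
      lt_of_le_of_ne (dotProduct_self_nonneg_fin3 w) (Ne.symm (mt dotProduct_self_eq_zero.mp hw))
    have hs : DifferentiableAt ℝ (fun w : Fin 3 → ℝ => √(dotProduct w w)) w :=
      (differentiable_dotProduct_self w).sqrt hpos.ne'
    exact (Real.differentiable_cos.differentiableAt).comp w (hs.const_mul ε)

/-- **`w ↦ sinc (ε √(w · w))` is differentiable on `ℝ³`.** -/
theorem differentiable_sinc_sqrt_dotProduct (ε : ℝ) :
    Differentiable ℝ (fun w : Fin 3 → ℝ => Real.sinc (ε * √(dotProduct w w))) := by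
  intro w
  by_cases hw : w = 0
  · subst hw
    have h : HasFDerivAt (fun w : Fin 3 → ℝ => Real.sinc (ε * √(dotProduct w w)) - 1) (0 : (Fin 3 → ℝ) →L[ℝ] ℝ) 0 := by
      refine hasFDerivAt_zero_of_sq_bound (C := 3 * ε ^ 2) (by simp) fun h => ?_
      calc |Real.sinc (ε * √(dotProduct h h)) - 1| ≤ (ε * √(dotProduct h h)) ^ 2 := abs_sinc_sub_one_le _
        _ = ε ^ 2 * dotProduct h h := by
            rw [mul_pow, Real.sq_sqrt (dotProduct_self_nonneg_fin3 h)]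
        _ ≤ 3 * ε ^ 2 * ‖h‖ ^ 2 := by
            have := dotProduct_self_le_three_mul_norm_sq h
            nlinarith [sq_nonneg ε]
    have h2 := h.differentiableAt.add_const 1
    simp only [sub_add_cancel] at h2
    exact h2
  · by_cases hε : ε = 0
    · subst hε
      simp only [zero_mul, Real.sinc_zero]
      exact differentiableAt_const _
    have hpos : 0 < dotProduct w w :=
      lt_of_le_of_ne (dotProduct_self_nonneg_fin3 w) (Ne.symm (mt dotProduct_self_eq_zero.mp hw))
    have hs : DifferentiableAt ℝ (fun w : Fin 3 → ℝ => ε * √(dotProduct w w)) w :=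
      ((differentiable_dotProduct_self w).sqrt hpos.ne').const_mul ε
    have hne : ε * √(dotProduct w w) ≠ 0 := mul_ne_zero hε (Real.sqrt_ne_zero'.mpr hpos)
    -- near the (nonzero) argument, `sinc = sin / id`
    have hsinc : DifferentiableAt ℝ Real.sinc (ε * √(dotProduct w w)) := by
      have hev : Real.sinc =ᶠ[𝓝 (ε * √(dotProduct w w))] fun x => Real.sin x / x := by
        filter_upwards [isOpen_ne.mem_nhds hne] with x hx
        exact Real.sinc_of_ne_zero hx
      refine DifferentiableAt.congr_of_eventuallyEq ?_ hev
      exact Real.differentiable_sin.differentiableAt.div differentiableAt_id hne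
    exact hsinc.comp w hs

end Calculus


/-! ## Linear pieces: `vecQuat`, `quatVec`, conjugate transposition; the `sinc` form of the density -/

section Linear

/-- `vecQuat` (quaternion coordinates of a `2 × 2` matrix) is differentiable: it is `ℝ`-linear. -/
theorem differentiable_vecQuat : Differentiable ℝ (vecQuat : Matrix (Fin 2) (Fin 2) ℂ → R4) := by
  let Lv : Matrix (Fin 2) (Fin 2) ℂ →ₗ[ℝ] R4 :=
    { toFun := vecQuat,
      map_add' := vecQuat_add,
      map_smul' := fun r M => by rw [RingHom.id_apply, ← vecQuat_smul, coe_real_smul_matrix] }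
  exact (LinearMap.toContinuousLinearMap Lv).differentiable

/-- `quatVec` is differentiable: it is `ℝ`-linear. -/
theorem differentiable_quatVec : Differentiable ℝ (quatVec : R4 → Matrix (Fin 2) (Fin 2) ℂ) := by
  let Lq : R4 →ₗ[ℝ] Matrix (Fin 2) (Fin 2) ℂ :=
    { toFun := quatVec,
      map_add' := quatVec_add,
      map_smul' := fun r x => by rw [RingHom.id_apply, quatVec_smul, coe_real_smul_matrix] }
  exact (LinearMap.toContinuousLinearMap Lq).differentiable

/-- Conjugate transposition of `2 × 2` complex matrices is differentiable (`ℝ`-linear). -/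
theorem differentiable_conjTranspose_two : Differentiable ℝ (fun W : Matrix (Fin 2) (Fin 2) ℂ => Wᴴ) := by
  let CT : Matrix (Fin 2) (Fin 2) ℂ →ₗ[ℝ] Matrix (Fin 2) (Fin 2) ℂ :=
    { toFun := fun W => Wᴴ,
      map_add' := fun A B => Matrix.conjTranspose_add A B,
      map_smul' := fun r A => by rw [Matrix.conjTranspose_smul, RingHom.id_apply, star_trivial] }
  exact (LinearMap.toContinuousLinearMap CT).differentiable

/-- **Lüscher's determinant in `sinc` form is a differentiable function of `j ∈ ℝ⁴`.** -/
theorem differentiable_luscherSinc (ε : ℝ) :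
    Differentiable ℝ (fun j : R4 => (1 - ε * j 0) * (Real.cos (ε * √(dotProduct ![j 1, j 2, j 3] ![j 1, j 2, j 3])) -
        j 0 * (ε * Real.sinc (ε * √(dotProduct ![j 1, j 2, j 3] ![j 1, j 2, j 3])))) ^ 2) := by
  have hproj : ∀ k : Fin 4, Differentiable ℝ (fun j : R4 => j k) := fun k =>
    (EuclideanSpace.proj k : R4 →L[ℝ] ℝ).differentiable
  have hw : Differentiable ℝ (fun j : R4 => (![j 1, j 2, j 3] : Fin 3 → ℝ)) := by
    refine differentiable_pi.mpr fun i => ?_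
    fin_cases i
    · exact hproj 1
    · exact hproj 2
    · exact hproj 3
  have hcos := (differentiable_cos_sqrt_dotProduct ε).comp hw
  have hsinc := (differentiable_sinc_sqrt_dotProduct ε).comp hw
  exact (((differentiable_const _).sub ((hproj 0).const_mul ε)).mul
    ((hcos.sub ((hproj 0).mul (hsinc.const_mul ε))).pow 2))

/-- **The booked per-link factor of the `SU(2)` kick IS Lüscher's determinant in `sinc` form**,
evaluated at `j = vecQuat (Uᴴ · quatVec J)` (GEN-8's `luscherDet_closedForm_eq_booked` + GEN-10's
`luscherIf_eq_sinc`). -/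
theorem su2KickJacFix_eq_luscherSinc (ε : ℝ) (U : (Matrix.specialUnitaryGroup (Fin 2) ℂ)) (J : R4) :
    (if Real.sin (angle J (vecQuat (U : Matrix (Fin 2) (Fin 2) ℂ))) = 0 then
          (1 - ε * ‖J‖ * Real.cos (angle J (vecQuat (U : Matrix (Fin 2) (Fin 2) ℂ)))) ^ 3
        else kickJac (ε * ‖J‖) 2 (angle J (vecQuat (U : Matrix (Fin 2) (Fin 2) ℂ)))) =
      (fun j : R4 => (1 - ε * j 0) * (Real.cos (ε * √(dotProduct ![j 1, j 2, j 3] ![j 1, j 2, j 3])) -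
        j 0 * (ε * Real.sinc (ε * √(dotProduct ![j 1, j 2, j 3] ![j 1, j 2, j 3])))) ^ 2) (vecQuat ((U : Matrix (Fin 2) (Fin 2) ℂ)ᴴ * quatVec J)) := by
  have h1 := luscherDet_closedForm_eq_booked ε U J
  rw [luscherIf_eq_sinc] at h1
  rw [← h1, lmulIso_apply, WilsonFlow.coe_inv_SU]

end Linear

end Summit.Ventures.LatticeQCDFlow.Exactness
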